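import Mathlib
import HarnessLib
import Literature.MathematicalPhysics.KineticTheory.HardSphereEulerProofs
import Literature.Analysis.FluidPDE.HardSpherePhaseSpaceProofs
import Summits.AtomisticToContinuum.HydrodynamicLimit.Theses.OneFlightGossipEngine
import Summits.AtomisticToContinuum.HydrodynamicLimit.Theorems.OneFlightGossipEngineKineticCurrentsLDAlongFamiliesTransferByNets
import Summits.AtomisticToContinuum.HydrodynamicLimit.Theorems.OneFlightGossipEngineLocalClampedTransferLDAlongFamiliesSAxisNetPrelim
import Summits.AtomisticToContinuum.HydrodynamicLimit.Theorems.OneFlightGossipEngineLocalClampedTransferLDAlongFamiliesSAxisNetPathwise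

/-!
# The one-row chain of the s-axis net — stub `stub_sAxisNet` of line `Sketch`,
# crux `LocalClampedTransferLDAlongFamilies` (stmt-AtomisticToContinuum-17691)

Route `OneFlightGossipEngine`, sub-problem `HydrodynamicLimit`. One row of the crux's functional at the family parameter
`s′` is `Y′ = w⁻¹X[ψ′] − w⁻¹(∫₀ʷ Σᵢ G′(Φ_r z i) dr − C′)` — a transfer-CLAMPED collisional row with test function `ψ′ = φ_{s′}`
minus a one-body window functional (the x-frozen EOS projection) and a centring. This file proves the CHAIN that bounds
its exponential moment under the law `μ′ = λ_{s′}` by `e^{ε(N+1)}` from: the same bound at tilt `4β` for the row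
`Y` at a nearby node (test function `ψ`, integrand `G`, centring `C`, law `μ = λ_{s₀}`); the static change of law
`∫ g dμ′ ≤ (∫ g² dμ)^{1/2} e^{κ(N+1)}`; the exponential moment of the window energy under `μ`; measurable versions of
`Y, Y′` on the good set; and the pathwise data `ψ′ − ψ` `L`-Lipschitz across contacts, `|G′ − G| ≤ ω₁ + ω₂‖v‖²`,
`|C′ − C| ≤ ω_c·w(N+1)`. Steps: change of law, Cauchy–Schwarz split of the square around `Y`
(`lintegral_exp_sq_le_split`), the node bound, and the pathwise bound
`4β(Y′ − Y) ≤ 4|β|(LV/2 + ω₁ + ω_c)(N+1) + 4|β|ω₂·(window energy)` (`abs_inv_window_mul_clampedRow_le`,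
`abs_inv_window_mul_sub_le`) priced by the window energy (`lintegral_exp_le_of_pathwise_windowEnergy`), assembled by
`tbn_chain_le`. Also: the spatial derivative of a jointly smooth test family is jointly continuous on the slab.

References: S. Olla, S. R. S. Varadhan, H.-T. Yau, Comm. Math. Phys. 155 (1993) §3; H. Spohn, *Large Scale Dynamics of
Interacting Particles* (1991), Part I §2.3.
-/

noncomputable section

open MeasureTheory Set Filter
open scoped ENNReal Topology BigOperators

namespace Summit.AtomisticToContinuum.HydrodynamicLimit.Theorems.LocalClampedTransferSketch

open Literature.Analysis.FluidPDE (HardSphereFlow Config liouville)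
open Literature.MathematicalPhysics.KineticTheory (T3 V3 hsDiameter)
open Literature.Analysis.FluidPDE Literature.MathematicalPhysics.KineticTheory Literature.Analysis.FunctionSpaces
open Summit.AtomisticToContinuum.HydrodynamicLimit.Theorems.KineticCurrentsLDAlongFamiliesSketch (tbn_chain_le)

/-! ### §1 Measurable versions on the good set; the test-family derivative as a slab field -/

/-- **A.e.-measurability from a measurable version on the good set**: if `Ỹ` is measurable and agrees with `Y` on
`Φ.good`, and `μ` does not charge the complement of the good set, then `exp(c·Y)` is `μ`-a.e.-measurable. -/
theorem aemeasurable_exp_of_eqOn_good {ε : ℝ} {n : ℕ} (Φ : HardSphereFlow (Torus.geometry (Fin 3)) ε n)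
    {μ : Measure (Config n (Fin 3) T3)} (hμ : μ Φ.goodᶜ = 0) {Y Yt : Config n (Fin 3) T3 → ℝ} (hYt : Measurable Yt)
    (heq : EqOn Yt Y Φ.good) (c : ℝ) :
    AEMeasurable (fun z => ENNReal.ofReal (Real.exp (c * Y z))) μ := by
  have hgood : ∀ᵐ z ∂μ, z ∈ Φ.good :=
    measure_eq_zero_iff_ae_notMem.1 hμ |>.mono fun z hz => by simpa using hz
  refine ⟨fun z => ENNReal.ofReal (Real.exp (c * Yt z)),
    (Real.measurable_exp.comp (measurable_const.mul hYt)).ennreal_ofReal, ?_⟩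
  filter_upwards [hgood] with z hz
  rw [heq hz]

/-- The difference of two functionals with measurable versions on the good set has a measurable version there, so
`exp(c·(Y′ − Y))` is `μ`-a.e.-measurable. -/
theorem aemeasurable_exp_sub_of_eqOn_good {ε : ℝ} {n : ℕ} (Φ : HardSphereFlow (Torus.geometry (Fin 3)) ε n)
    {μ : Measure (Config n (Fin 3) T3)} (hμ : μ Φ.goodᶜ = 0) {Y Yt Y' Yt' : Config n (Fin 3) T3 → ℝ}
    (hYt : Measurable Yt) (heq : EqOn Yt Y Φ.good) (hYt' : Measurable Yt') (heq' : EqOn Yt' Y' Φ.good) (c : ℝ) :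
    AEMeasurable (fun z => ENNReal.ofReal (Real.exp (c * (Y' z - Y z)))) μ :=
  aemeasurable_exp_of_eqOn_good Φ hμ (hYt'.sub hYt) (fun z hz => by simp only [Pi.sub_apply, heq hz, heq' hz]) c

/-- **The spatial derivative of a jointly smooth test family is jointly continuous on the slab** `[0,t₁] × 𝕋³`
(for `t₁ > 0` it is jointly Lipschitz there, `exists_lipschitz_slab_Icc`, and the minimal-image distance is dominated by
the quotient metric; for `t₁ = 0` the single slice is smooth; for `t₁ < 0` the slab is empty). -/
theorem continuousOn_slab_partialDeriv {t₁ : ℝ} {φ : ℝ → T3 → ℝ} (hφ : Torus.IsSmoothSpaceTimeOn (Icc 0 t₁) φ)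
    (k : Fin 3) : ContinuousOn (fun p : ℝ × T3 => Torus.partialDeriv k (φ p.1) p.2) (Icc 0 t₁ ×ˢ univ) := by
  rcases lt_trichotomy t₁ 0 with ht | rfl | ht
  · rw [Icc_eq_empty (not_le.2 ht), empty_prod]
    exact continuousOn_empty _
  · have h0 : Torus.IsSmooth (φ 0) := hφ.isSmooth_slice ⟨le_rfl, le_rfl⟩
    have hc : Continuous fun p : ℝ × T3 => Torus.partialDeriv k (φ 0) p.2 :=
      (h0.partialDeriv k).continuous.comp continuous_snd
    refine hc.continuousOn.congr fun p hp => ?_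
    obtain ⟨hp1, -⟩ := mem_prod.1 hp
    have : p.1 = 0 := le_antisymm hp1.2 hp1.1
    simp [this]
  · have hU : UniqueDiffOn ℝ (Icc (0 : ℝ) t₁) := uniqueDiffOn_Icc ht
    obtain ⟨K, hK, h⟩ := exists_lipschitz_slab_Icc (hφ.partialDeriv hU k) ht
    rw [Metric.continuousOn_iff]
    intro p hp e he
    obtain ⟨hp1, -⟩ := mem_prod.1 hp
    have hKpos : 0 < (K + 1) * (1 + Real.sqrt (Fintype.card (Fin 3))) := mul_pos (by linarith) (by positivity)
    refine ⟨e / ((K + 1) * (1 + Real.sqrt (Fintype.card (Fin 3)))), div_pos he hKpos, fun q hq hd => ?_⟩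
    obtain ⟨hq1, -⟩ := mem_prod.1 hq
    have hqp := h q.1 hq1 p.1 hp1 q.2 p.2
    rw [Real.dist_eq, ← Real.norm_eq_abs]
    refine hqp.trans_lt ?_
    have hd1 : |q.1 - p.1| ≤ dist q p := by rw [← Real.dist_eq, Prod.dist_eq]; exact le_max_left _ _
    have hd2 : Torus.euclidDist q.2 p.2 ≤ Real.sqrt (Fintype.card (Fin 3)) * dist q p := by
      refine (Torus.euclidDist_le_holds q.2 p.2).trans (mul_le_mul_of_nonneg_left ?_ (Real.sqrt_nonneg _))
      rw [← dist_eq_norm, Prod.dist_eq]; exact le_max_right _ _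
    have hd0 : 0 ≤ Torus.euclidDist q.2 p.2 := by rw [Torus.euclidDist_eq]; exact norm_nonneg _
    calc K * (|q.1 - p.1| + Torus.euclidDist q.2 p.2)
        ≤ (K + 1) * ((1 + Real.sqrt (Fintype.card (Fin 3))) * dist q p) := by
          refine mul_le_mul (by linarith) ?_ (add_nonneg (abs_nonneg _) hd0) (by linarith)
          nlinarith [Real.sqrt_nonneg (Fintype.card (Fin 3) : ℝ), dist_nonneg (x := q) (y := p)]
      _ < (K + 1) * ((1 + Real.sqrt (Fintype.card (Fin 3))) * (e / ((K + 1) * (1 + Real.sqrt (Fintype.card (Fin 3)))))) := by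
          gcongr
      _ = e := by field_simp

/-! ### §2 The one-row chain -/

/-- **The one-row chain of the s-axis net.** Fix `σ, τ > 0`, `V ≥ 0`, `N`, a flow `Φ`, laws `μ` (node) and `μ′` (actual)
carried by the good set / dominated by Liouville, clamp weights `ω_i = 𝟙{act_i ≤ V}` of the window transfer activity,
an impulse `δ` dominated by the transfer impulse, test functions `ψ` (node) and `ψ′` with `ψ′ − ψ` `L`-Lipschitz across
contacts, continuous one-body integrands with `|G′ − G| ≤ ω₁ + ω₂‖v‖²`, centrings with `|C′ − C| ≤ ω_c w(N+1)`. If the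
node row `Y = w⁻¹X[ψ] − w⁻¹(∫₀ʷΣᵢG − C)` has `∫exp(4βY)dμ ≤ e^{ε(N+1)}`, the law changes at cost `κ`, the window energy
has `γ`-exponential moment `e^{κ(N+1)}` under `μ`, both rows have measurable versions on the good set, and the budgets
`4|β|(LV/2 + ω₁ + ω_c) ≤ c`, `4|β|ω₂ ≤ γ`, `κ + ε/4 + (c + κ)/4 ≤ ε` hold, then `∫exp(βY′)dμ′ ≤ e^{ε(N+1)}` (the node bound at the TARGET precision `ε` suffices: it is taken to the power `1/4` by the two Cauchy–Schwarz steps). -/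
theorem row_chain {σ τ V β ε κ γ c ω₁ ω₂ ωc L w : ℝ} {N : ℕ} (hσ : 0 < σ) (hτ : 0 < τ) (hV : 0 ≤ V) (hL : 0 ≤ L)
    (Φ : HardSphereFlow (Torus.geometry (Fin 3)) (hsDiameter σ N) (N + 1))
    {μ μ' : Measure (Config (N + 1) (Fin 3) T3)} (hμ : μ Φ.goodᶜ = 0)
    (hμ'L : μ' ≪ liouville (Torus.geometry (Fin 3)) (N + 1) (hsDiameter σ N))
    {ψ ψ' : T3 → ℝ} (hLip : ∀ x y, |(ψ' x - ψ x) - (ψ' y - ψ y)| ≤ L * Torus.euclidDist x y)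
    {G G' : T3 × V3 → ℝ} (hGc : Continuous G) (hG'c : Continuous G') (hGG : ∀ y, |G' y - G y| ≤ ω₁ + ω₂ * ‖y.2‖ ^ 2)
    {C C' : ℝ} (hCC : |C' - C| ≤ ωc * (w * ((N : ℝ) + 1)))
    {δ : V3 → V3 → ℝ} (hδ : ∀ v v', |δ v v'| ≤ ‖v' - v‖ + |‖v'‖ ^ 2 - ‖v‖ ^ 2| / 2)
    (hw : w = τ * ((N : ℝ) + 1) ^ (-(1 / 3 : ℝ)))
    (hlaw : ∀ g : Config (N + 1) (Fin 3) T3 → ℝ≥0∞,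
      AEMeasurable g (liouville (Torus.geometry (Fin 3)) (N + 1) (hsDiameter σ N)) →
      ∫⁻ z, g z ∂μ' ≤ (∫⁻ z, g z ^ 2 ∂μ) ^ (1 / 2 : ℝ) * ENNReal.ofReal (Real.exp (κ * ((N : ℝ) + 1))))
    (hT : ∫⁻ z, ENNReal.ofReal (Real.exp (γ * ∑ i : Fin (N + 1),
      w⁻¹ * ∫ r in (0 : ℝ)..w, ‖((Φ.flow r z) i).2‖ ^ 2)) ∂μ ≤ ENNReal.ofReal (Real.exp (κ * ((N : ℝ) + 1))))
    (hnode : ∫⁻ z, ENNReal.ofReal (Real.exp (4 * β * (w⁻¹ *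
        Φ.collisionSum (Ioc 0 w) (fun c =>
          (if σ / τ * Φ.collisionSum (Ioc 0 w) (fun c' => if c'.fst = c.fst then ‖c'.postVel.1 - c'.preVel.1‖ +
              |‖c'.postVel.1‖ ^ 2 - ‖c'.preVel.1‖ ^ 2| / 2 else 0) z ≤ V then (1 : ℝ) else 0) *
          (if σ / τ * Φ.collisionSum (Ioc 0 w) (fun c' => if c'.fst = c.snd then ‖c'.postVel.1 - c'.preVel.1‖ +
              |‖c'.postVel.1‖ ^ 2 - ‖c'.preVel.1‖ ^ 2| / 2 else 0) z ≤ V then (1 : ℝ) else 0) *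
          ((ψ c.fstPos - ψ c.sndPos) * δ c.preVel.1 c.postVel.1) / 2) z -
        w⁻¹ * ((∫ r in (0 : ℝ)..w, ∑ i : Fin (N + 1), G ((Φ.flow r z) i)) - C)))) ∂μ ≤
      ENNReal.ofReal (Real.exp (ε * ((N : ℝ) + 1))))
    (hYm : ∃ Yt : Config (N + 1) (Fin 3) T3 → ℝ, Measurable Yt ∧ EqOn Yt (fun z => w⁻¹ *
        Φ.collisionSum (Ioc 0 w) (fun c =>
          (if σ / τ * Φ.collisionSum (Ioc 0 w) (fun c' => if c'.fst = c.fst then ‖c'.postVel.1 - c'.preVel.1‖ +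
              |‖c'.postVel.1‖ ^ 2 - ‖c'.preVel.1‖ ^ 2| / 2 else 0) z ≤ V then (1 : ℝ) else 0) *
          (if σ / τ * Φ.collisionSum (Ioc 0 w) (fun c' => if c'.fst = c.snd then ‖c'.postVel.1 - c'.preVel.1‖ +
              |‖c'.postVel.1‖ ^ 2 - ‖c'.preVel.1‖ ^ 2| / 2 else 0) z ≤ V then (1 : ℝ) else 0) *
          ((ψ c.fstPos - ψ c.sndPos) * δ c.preVel.1 c.postVel.1) / 2) z -
        w⁻¹ * ((∫ r in (0 : ℝ)..w, ∑ i : Fin (N + 1), G ((Φ.flow r z) i)) - C)) Φ.good)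
    (hY'm : ∃ Yt : Config (N + 1) (Fin 3) T3 → ℝ, Measurable Yt ∧ EqOn Yt (fun z => w⁻¹ *
        Φ.collisionSum (Ioc 0 w) (fun c =>
          (if σ / τ * Φ.collisionSum (Ioc 0 w) (fun c' => if c'.fst = c.fst then ‖c'.postVel.1 - c'.preVel.1‖ +
              |‖c'.postVel.1‖ ^ 2 - ‖c'.preVel.1‖ ^ 2| / 2 else 0) z ≤ V then (1 : ℝ) else 0) *
          (if σ / τ * Φ.collisionSum (Ioc 0 w) (fun c' => if c'.fst = c.snd then ‖c'.postVel.1 - c'.preVel.1‖ +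
              |‖c'.postVel.1‖ ^ 2 - ‖c'.preVel.1‖ ^ 2| / 2 else 0) z ≤ V then (1 : ℝ) else 0) *
          ((ψ' c.fstPos - ψ' c.sndPos) * δ c.preVel.1 c.postVel.1) / 2) z -
        w⁻¹ * ((∫ r in (0 : ℝ)..w, ∑ i : Fin (N + 1), G' ((Φ.flow r z) i)) - C')) Φ.good)
    (hbudget : 4 * |β| * (L * V / 2 + ω₁ + ωc) ≤ c) (hγ' : 4 * |β| * ω₂ ≤ γ) (hsum : κ + ε / 4 + (c + κ) / 4 ≤ ε) :
    ∫⁻ z, ENNReal.ofReal (Real.exp (β * (w⁻¹ *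
        Φ.collisionSum (Ioc 0 w) (fun c =>
          (if σ / τ * Φ.collisionSum (Ioc 0 w) (fun c' => if c'.fst = c.fst then ‖c'.postVel.1 - c'.preVel.1‖ +
              |‖c'.postVel.1‖ ^ 2 - ‖c'.preVel.1‖ ^ 2| / 2 else 0) z ≤ V then (1 : ℝ) else 0) *
          (if σ / τ * Φ.collisionSum (Ioc 0 w) (fun c' => if c'.fst = c.snd then ‖c'.postVel.1 - c'.preVel.1‖ +
              |‖c'.postVel.1‖ ^ 2 - ‖c'.preVel.1‖ ^ 2| / 2 else 0) z ≤ V then (1 : ℝ) else 0) *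
          ((ψ' c.fstPos - ψ' c.sndPos) * δ c.preVel.1 c.postVel.1) / 2) z -
        w⁻¹ * ((∫ r in (0 : ℝ)..w, ∑ i : Fin (N + 1), G' ((Φ.flow r z) i)) - C')))) ∂μ' ≤
      ENNReal.ofReal (Real.exp (ε * ((N : ℝ) + 1))) := by
  -- abbreviations
  set η : Config (N + 1) (Fin 3) T3 → Fin (N + 1) → ℝ := fun z i =>
    if σ / τ * Φ.collisionSum (Ioc 0 w) (fun c' => if c'.fst = i then ‖c'.postVel.1 - c'.preVel.1‖ +
      |‖c'.postVel.1‖ ^ 2 - ‖c'.preVel.1‖ ^ 2| / 2 else 0) z ≤ V then (1 : ℝ) else 0 with hη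
  set X : (T3 → ℝ) → Config (N + 1) (Fin 3) T3 → ℝ := fun χ z => Φ.collisionSum (Ioc 0 w)
    (fun c => η z c.fst * η z c.snd * ((χ c.fstPos - χ c.sndPos) * δ c.preVel.1 c.postVel.1) / 2) z with hX
  set A : (T3 × V3 → ℝ) → ℝ → Config (N + 1) (Fin 3) T3 → ℝ := fun F C₀ z =>
    (∫ r in (0 : ℝ)..w, ∑ i : Fin (N + 1), F ((Φ.flow r z) i)) - C₀ with hA
  set Y : Config (N + 1) (Fin 3) T3 → ℝ := fun z => w⁻¹ * X ψ z - w⁻¹ * A G C z with hY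
  set Y' : Config (N + 1) (Fin 3) T3 → ℝ := fun z => w⁻¹ * X ψ' z - w⁻¹ * A G' C' z with hY'
  set W : Config (N + 1) (Fin 3) T3 → ℝ := fun z => ∑ i : Fin (N + 1), w⁻¹ * ∫ r in (0 : ℝ)..w, ‖((Φ.flow r z) i).2‖ ^ 2
    with hW
  change ∫⁻ z, ENNReal.ofReal (Real.exp (β * Y' z)) ∂μ' ≤ ENNReal.ofReal (Real.exp (ε * ((N : ℝ) + 1)))
  change ∫⁻ z, ENNReal.ofReal (Real.exp (4 * β * Y z)) ∂μ ≤ ENNReal.ofReal (Real.exp (ε * ((N : ℝ) + 1))) at hnode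
  change ∃ Yt, Measurable Yt ∧ EqOn Yt Y Φ.good at hYm
  change ∃ Yt, Measurable Yt ∧ EqOn Yt Y' Φ.good at hY'm
  change ∫⁻ z, ENNReal.ofReal (Real.exp (γ * W z)) ∂μ ≤ ENNReal.ofReal (Real.exp (κ * ((N : ℝ) + 1))) at hT
  obtain ⟨Yt, hYt, heqY⟩ := hYm
  obtain ⟨Yt', hYt', heqY'⟩ := hY'm
  have hwpos : 0 < w := by rw [hw]; exact mul_pos hτ (Real.rpow_pos_of_pos (by positivity) _)
  have hn : (0 : ℝ) ≤ (N : ℝ) + 1 := by positivity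
  have hμL : μ' Φ.goodᶜ = 0 := hμ'L Φ.measure_compl_good
  have hLgood : liouville (Torus.geometry (Fin 3)) (N + 1) (hsDiameter σ N) Φ.goodᶜ = 0 := Φ.measure_compl_good
  -- (a) change of law
  have haa : ∫⁻ z, ENNReal.ofReal (Real.exp (β * Y' z)) ∂μ' ≤
      (∫⁻ z, ENNReal.ofReal (Real.exp (β * Y' z)) ^ 2 ∂μ) ^ (1 / 2 : ℝ) *
        ENNReal.ofReal (Real.exp (κ * ((N : ℝ) + 1))) :=
    hlaw _ (aemeasurable_exp_of_eqOn_good Φ hLgood hYt' heqY' β)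
  -- (b) Cauchy–Schwarz split around the node row
  have hbb := lintegral_exp_sq_le_split (μ := μ) β (aemeasurable_exp_of_eqOn_good Φ hμ hYt heqY (4 * β))
    (aemeasurable_exp_sub_of_eqOn_good Φ hμ hYt heqY hYt' heqY' (4 * β))
  -- (d) the pathwise bound of `4β(Y′ − Y)` on good orbits
  have hpath : ∀ z ∈ Φ.good, 4 * β * (Y' z - Y z) ≤ c * ((N : ℝ) + 1) + (4 * |β| * ω₂) * W z := by
    intro z hz
    -- the clamped-row part
    have hXX : X ψ' z - X ψ z = Φ.collisionSum (Ioc 0 w)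
        (fun c => η z c.fst * η z c.snd * ((((fun x => ψ' x - ψ x) c.fstPos) - ((fun x => ψ' x - ψ x) c.sndPos)) *
          δ c.preVel.1 c.postVel.1) / 2) z := by
      simp only [hX]
      rw [clampedRow_sub_eq Φ hz w (η z) ψ ψ' δ]
    have hX1 : |w⁻¹ * (X ψ' z - X ψ z)| ≤ L * V * ((N : ℝ) + 1) / 2 := by
      rw [hXX, hη, hw]
      exact abs_inv_window_mul_clampedRow_le hσ hτ hV hL Φ hz (ψ := fun x => ψ' x - ψ x) hLip hδ
    -- the one-body part
    have hA1 : |w⁻¹ * (A G' C' z - A G C z)| ≤ (ω₁ + ωc) * ((N : ℝ) + 1) + ω₂ * W z := by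
      have h1 := abs_inv_window_mul_sub_le Φ hz hG'c hGc hGG hwpos
      have e : w⁻¹ * (A G' C' z - A G C z) =
          w⁻¹ * ((∫ r in (0 : ℝ)..w, ∑ i : Fin (N + 1), G' ((Φ.flow r z) i)) -
            ∫ r in (0 : ℝ)..w, ∑ i : Fin (N + 1), G ((Φ.flow r z) i)) - w⁻¹ * (C' - C) := by
        simp only [hA]; ring
      rw [e]
      refine (abs_sub _ _).trans ?_
      have h2 : |w⁻¹ * (C' - C)| ≤ ωc * ((N : ℝ) + 1) := by
        rw [abs_mul, abs_of_pos (inv_pos.2 hwpos)]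
        calc w⁻¹ * |C' - C| ≤ w⁻¹ * (ωc * (w * ((N : ℝ) + 1))) := mul_le_mul_of_nonneg_left hCC (inv_pos.2 hwpos).le
          _ = ωc * ((N : ℝ) + 1) := by field_simp
      have h1' : |w⁻¹ * ((∫ r in (0 : ℝ)..w, ∑ i : Fin (N + 1), G' ((Φ.flow r z) i)) -
          ∫ r in (0 : ℝ)..w, ∑ i : Fin (N + 1), G ((Φ.flow r z) i))| ≤ ω₁ * ((N : ℝ) + 1) + ω₂ * W z := by
        simpa [hW, Nat.cast_add_one] using h1
      linarith
    have hYY : Y' z - Y z = w⁻¹ * (X ψ' z - X ψ z) - w⁻¹ * (A G' C' z - A G C z) := by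
      simp only [hY, hY']; ring
    rw [hYY]
    have hb := abs_le.1 hX1
    have ha := abs_le.1 hA1
    have hW0 : 0 ≤ W z := windowEnergy_nonneg Φ z hwpos
    have h4 : 4 * β * (w⁻¹ * (X ψ' z - X ψ z) - w⁻¹ * (A G' C' z - A G C z)) ≤
        4 * |β| * (|w⁻¹ * (X ψ' z - X ψ z)| + |w⁻¹ * (A G' C' z - A G C z)|) := by
      have := abs_le.1 (show |4 * β * (w⁻¹ * (X ψ' z - X ψ z) - w⁻¹ * (A G' C' z - A G C z))| ≤
        4 * |β| * (|w⁻¹ * (X ψ' z - X ψ z)| + |w⁻¹ * (A G' C' z - A G C z)|) from by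
          rw [abs_mul, abs_mul, abs_of_pos (by norm_num : (0 : ℝ) < 4)]
          exact mul_le_mul_of_nonneg_left (abs_sub _ _) (by positivity))
      exact this.2
    refine h4.trans ?_
    have hβ0 : 0 ≤ |β| := abs_nonneg β
    calc 4 * |β| * (|w⁻¹ * (X ψ' z - X ψ z)| + |w⁻¹ * (A G' C' z - A G C z)|)
        ≤ 4 * |β| * (L * V * ((N : ℝ) + 1) / 2 + ((ω₁ + ωc) * ((N : ℝ) + 1) + ω₂ * W z)) :=
          mul_le_mul_of_nonneg_left (add_le_add hX1 hA1) (by positivity)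
      _ = 4 * |β| * (L * V / 2 + ω₁ + ωc) * ((N : ℝ) + 1) + 4 * |β| * ω₂ * W z := by ring
      _ ≤ c * ((N : ℝ) + 1) + 4 * |β| * ω₂ * W z := by
          exact add_le_add (mul_le_mul_of_nonneg_right hbudget hn) le_rfl
  -- (d') priced by the window energy
  have hdd : ∫⁻ z, ENNReal.ofReal (Real.exp (4 * β * (Y' z - Y z))) ∂μ ≤
      ENNReal.ofReal (Real.exp (c * ((N : ℝ) + 1))) * ENNReal.ofReal (Real.exp (κ * ((N : ℝ) + 1))) := by
    have h := lintegral_exp_le_of_pathwise_windowEnergy Φ hμ (D := fun z => Y' z - Y z) (β := 4 * β)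
      (c := c * ((N : ℝ) + 1)) hwpos hγ' hpath
    exact h.trans (mul_le_mul' le_rfl hT)
  exact tbn_chain_le haa hbb hnode hdd hn hsum

/-- **Registered chain prelim of stub `stub_sAxisNet`** (line `Sketch`, crux `LocalClampedTransferLDAlongFamilies`): the
spatial derivative of a jointly smooth test family is jointly continuous on the slab `[0,t₁] × 𝕋³`. -/
theorem stub_sAxisNetChain :
    ∀ (t₁ : ℝ) (φ : ℝ → T3 → ℝ), Torus.IsSmoothSpaceTimeOn (Set.Icc 0 t₁) φ → ∀ k : Fin 3,
      ContinuousOn (fun p : ℝ × T3 => Torus.partialDeriv k (φ p.1) p.2) (Set.Icc 0 t₁ ×ˢ Set.univ) :=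
  fun _ _ hφ k => continuousOn_slab_partialDeriv hφ k

end Summit.AtomisticToContinuum.HydrodynamicLimit.Theorems.LocalClampedTransferSketch

end
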